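import Summits.QuantumFields.BalabanUV.Beta.D1BFx.GluonNeedleGlue

/-!
# `BalabanUV.Beta.D1BFx.GluonNeedleGlueT12` — road «BF-x» for binder row D1, slot (K), END row `hGrp gN`, «GN-T12 ∕ GLUE»: THE GLUON NEEDLE ROWS T₁ (`SbT ⊗ SbRc`)
# AND T₂ (`SbRc ⊗ SbT`) FROM THEIR THREE PIECES EACH — `h₁`, `h₂` of `NeedleRowGlue.abs_gN_row_le_of_tables` VERBATIM from ONE n-uniform bound per piece
# (`SbT ⊗ dip` with weight `cK`, `SbT ⊗ ndl`, `SbT ⊗ proj`; mirror for T₂) and the pins (`hlam`, `cE = n⁴`, `cR = −cE`: `ωgl·cE·cR·n⁻⁸ = −2N²`, n-free), `C₁, C₂ := 2N²·(C_d + C_n + C_p)` —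
# the companion of `GluonNeedleGlue.h₃_of_cells` (p262454)

HONEST DEPENDENCY (cell records, verbatim): «continuum YM on T⁴ ⇐ BetaPertH ∧ nine spine estimates (0/9 proved); BetaPertH ⇐ (D1) ∧ (D4) ∧
CAP+tail; G-an2-4 gates asym, D1 and NE2/3/4.»  HONEST FRAMING (cell contract, verbatim): «discharging `BetaPertH` makes Bałaban's UV stability
UNCONDITIONAL — a real constructive-QFT result; it is NOT the continuum limit and NOT the Clay problem.»  THIS MODULE DISCHARGES NOTHING of the
wall: [folklore] bookkeeping BY NAME over `GluonNeedleGlue` (uniform piece localisation, `conv_cell`, `fullSum_lin3`, `cellSum`), gan24-leaf-05-g41's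
`GluonNeedleSplit.biBubbleTable_right∕left_SbRblk_eq` ∕ `_SbRc_eq` ∕ `prefactor₁_eq` and `SectorRecut.exists_biLoc_SbT`.  No `def`, no `def … : Prop`, nothing
cited, 0 sorry.  The PIECE BOUNDS are HYPOTHESES (claimables «GN-P», «GN-K», «GN-Q» of the owner's table «GN-CELLS»); the pins are slot (K)'s displayed letters.
Root-level binders hW ∕ hR-sockets ∕ hSX-socket ∕ D1Tel ∕ D1Rep — 0 discharged; (K) NOT closed; NOT D1, NOT `BetaPertH`, NOT continuum, NOT Clay.

ABSOLUTE RULE (cell charter, verbatim): «No internally-minted statement may enter as a cited fact. Every hypothesis is either kernel-proved in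
this package or a verbatim quotation of a PUBLISHED theorem with page reference. The manuscript(s) under audit are NOT citable for their own
disputed steps — they are the thing under adjudication; programme-internal (2001/route/tribunal) claims are never citable.»

CONTENT (`a > 0`, block side `n ≥ 1`).
* §1 [folklore] `sum_avg_three`, `abs_three_le`, **`fullSum_right_SbRblk_eq`** ∕ **`fullSum_left_SbRblk_eq`** (the (1.22) sum of `S ⊗ SbRblk` ∕ `SbRblk ⊗ T` at one base
  site = the weighted three-term combination of the piece sums, for a stencil family bi-localised at its bonds uniformly), **`h₁_of_pieces`**, **`h₂_of_pieces`**.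
Unit `b2b-balaban-beta-d1-p2` (gen 10), road «BF-x» OWNER; `LEAVES-BFx.md` row (N) «GN-T12∕GLUE».
-/

noncomputable section

namespace Summit.QuantumFields.BalabanUV.Beta.D1BFx.GluonNeedleGlueT12

open Finset Filter Topology
open scoped BigOperators
open Literature.MathematicalPhysics.QuantumFieldTheory.Balaban1983to89
open Literature.MathematicalPhysics.QuantumFieldTheory.Balaban1983to89.Beta
open ExpKernelCalculus (Site MKer Decays BiLoc)
open DyadicShell (Pt toReal toReal_apply)
open WindowIdentification (psum fullSum fullSum_add fullSum_const_mul exists_tendsto_psum_add)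
open DressedMomentNormalisation (resSite)
open Summit.QuantumFields.BalabanUV.Beta.TameKernelCalculus (Spr Loc)
open Summit.QuantumFields.BalabanUV.Beta.D1BFx.ReducedKernel (StencilR)
open Summit.QuantumFields.BalabanUV.Beta.D1BFx.GluonLeg (Ga)
open Summit.QuantumFields.BalabanUV.Beta.D1BFx.SectorRecut (SbT SbRc exists_biLoc_SbT)
open Summit.QuantumFields.BalabanUV.Beta.D1BFx.GaugeJetLocal (SbRblk)
open Summit.QuantumFields.BalabanUV.Beta.D1BFx.GaugeJetWords (exists_biLoc_SbRblk)
open Summit.QuantumFields.BalabanUV.Beta.D1BFx.FineHessianSectors (biBubbleTable)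
open Summit.QuantumFields.BalabanUV.Beta.D1BFx.GluonNeedleSplit (projPiece dipPiece ndlPiece biBubbleTable_right_SbRblk_eq biBubbleTable_left_SbRblk_eq
  biBubbleTable_right_SbRc_eq biBubbleTable_left_SbRc_eq prefactor₁_eq)
open Summit.QuantumFields.BalabanUV.Beta.D1BFx.GluonNeedleGlue (cellSum cellSum_def conv_cell fullSum_lin3 exists_biLoc_projPiece exists_biLoc_dipPiece
  exists_biLoc_ndlPiece)

variable (n : ℕ) [NeZero n] (a : ℝ) (cK cQ : ℝ)

/-! ## §1 `h₁` and `h₂` from their three pieces each -/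


omit [NeZero n] in
/-- [folklore] the base average of a three-term combination. -/
theorem sum_avg_three (s : Finset Pt) (r c : ℝ) (F₁ F₂ F₃ : Pt → ℝ) :
    ∑ b ∈ s, r * (c * F₁ b + F₂ b - F₃ b) = c * ∑ b ∈ s, r * F₁ b + ∑ b ∈ s, r * F₂ b - ∑ b ∈ s, r * F₃ b := by
  have e : ∀ b ∈ s, r * (c * F₁ b + F₂ b - F₃ b) = c * (r * F₁ b) + r * F₂ b - r * F₃ b := fun b _ => by ring
  rw [Finset.sum_congr rfl e]
  simp only [Finset.sum_add_distrib, Finset.sum_sub_distrib, ← Finset.mul_sum]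

omit [NeZero n] in
/-- [folklore] the triangle inequality for the three-term combination with its weights inside. -/
theorem abs_three_le (c S₁ S₂ S₃ : ℝ) : |c * S₁ + S₂ - S₃| ≤ |c * S₁| + |S₂| + |S₃| := by
  calc |c * S₁ + S₂ - S₃| ≤ |c * S₁ + S₂| + |S₃| := abs_sub _ _
    _ ≤ |c * S₁| + |S₂| + |S₃| := add_le_add (abs_add_le _ _) le_rfl

/-- [folklore] **THE (1.22) SUM OF `S ⊗ SbRblk` AT ONE BASE SITE = THE WEIGHTED SUM OF THE THREE PIECE SUMS**, for a stencil family `S` bi-localised at its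
bonds UNIFORMLY (the transverse bordering stencil `SbT`: `SectorRecut.exists_biLoc_SbT`). -/
theorem fullSum_right_SbRblk_eq (ha : 0 < a) (hGa : Spr (Ga n a)) {S : StencilR} {Cs δs : ℝ} (hS : ∀ κ u, BiLoc (S κ u) u u Cs δs) (hδs : 0 < δs)
    (μ ν : Fin 4) (b : Pt) :
    fullSum (fun w : Pt => toReal w μ * toReal w ν * biBubbleTable (Ga n a) (Ga n a) S (SbRblk n a cK cQ) μ ν (b + w) b) =
      cK * fullSum (fun w : Pt => toReal w μ * toReal w ν * biBubbleTable (Ga n a) (Ga n a) S (dipPiece n a) μ ν (b + w) b)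
        + fullSum (fun w : Pt => toReal w μ * toReal w ν * biBubbleTable (Ga n a) (Ga n a) S (ndlPiece n a cQ) μ ν (b + w) b)
        - fullSum (fun w : Pt => toReal w μ * toReal w ν * biBubbleTable (Ga n a) (Ga n a) S (projPiece n a) μ ν (b + w) b) := by
  obtain ⟨Cp, δp, hδp, hP⟩ := exists_biLoc_projPiece n a ha
  obtain ⟨Cd, δd, hδd, hD⟩ := exists_biLoc_dipPiece n a ha
  obtain ⟨Cn, δn, hδn, hN⟩ := exists_biLoc_ndlPiece n a ha cQ
  have hSloc : ∀ κ u, Loc (S κ u) := fun κ u => ⟨u, u, Cs, δs, hδs, hS κ u⟩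
  have e : (fun w : Pt => toReal w μ * toReal w ν * biBubbleTable (Ga n a) (Ga n a) S (SbRblk n a cK cQ) μ ν (b + w) b) =
      fun w : Pt => cK * (toReal w μ * toReal w ν * biBubbleTable (Ga n a) (Ga n a) S (dipPiece n a) μ ν (b + w) b)
        + (toReal w μ * toReal w ν * biBubbleTable (Ga n a) (Ga n a) S (ndlPiece n a cQ) μ ν (b + w) b)
        - (toReal w μ * toReal w ν * biBubbleTable (Ga n a) (Ga n a) S (projPiece n a) μ ν (b + w) b) := by
    funext w
    rw [biBubbleTable_right_SbRblk_eq (n := n) (a := a) (cK := cK) (cQ := cQ) (κ := μ) (lam := ν) (p := b + w) (u := b) hGa ha hSloc]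
    ring
  rw [e]
  exact fullSum_lin3 cK (conv_cell hGa hS hδs hD hδd μ ν b) (conv_cell hGa hS hδs hN hδn μ ν b) (conv_cell hGa hS hδs hP hδp μ ν b)

/-- [folklore] **THE (1.22) SUM OF `SbRblk ⊗ T` AT ONE BASE SITE = THE WEIGHTED SUM OF THE THREE PIECE SUMS** (mirror). -/
theorem fullSum_left_SbRblk_eq (ha : 0 < a) (hGa : Spr (Ga n a)) {T : StencilR} {Ct δt : ℝ} (hT : ∀ κ u, BiLoc (T κ u) u u Ct δt) (hδt : 0 < δt)
    (μ ν : Fin 4) (b : Pt) :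
    fullSum (fun w : Pt => toReal w μ * toReal w ν * biBubbleTable (Ga n a) (Ga n a) (SbRblk n a cK cQ) T μ ν (b + w) b) =
      cK * fullSum (fun w : Pt => toReal w μ * toReal w ν * biBubbleTable (Ga n a) (Ga n a) (dipPiece n a) T μ ν (b + w) b)
        + fullSum (fun w : Pt => toReal w μ * toReal w ν * biBubbleTable (Ga n a) (Ga n a) (ndlPiece n a cQ) T μ ν (b + w) b)
        - fullSum (fun w : Pt => toReal w μ * toReal w ν * biBubbleTable (Ga n a) (Ga n a) (projPiece n a) T μ ν (b + w) b) := by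
  obtain ⟨Cp, δp, hδp, hP⟩ := exists_biLoc_projPiece n a ha
  obtain ⟨Cd, δd, hδd, hD⟩ := exists_biLoc_dipPiece n a ha
  obtain ⟨Cn, δn, hδn, hN⟩ := exists_biLoc_ndlPiece n a ha cQ
  have hTloc : ∀ κ u, Loc (T κ u) := fun κ u => ⟨u, u, Ct, δt, hδt, hT κ u⟩
  have e : (fun w : Pt => toReal w μ * toReal w ν * biBubbleTable (Ga n a) (Ga n a) (SbRblk n a cK cQ) T μ ν (b + w) b) =
      fun w : Pt => cK * (toReal w μ * toReal w ν * biBubbleTable (Ga n a) (Ga n a) (dipPiece n a) T μ ν (b + w) b)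
        + (toReal w μ * toReal w ν * biBubbleTable (Ga n a) (Ga n a) (ndlPiece n a cQ) T μ ν (b + w) b)
        - (toReal w μ * toReal w ν * biBubbleTable (Ga n a) (Ga n a) (projPiece n a) T μ ν (b + w) b) := by
    funext w
    rw [biBubbleTable_left_SbRblk_eq (n := n) (a := a) (cK := cK) (cQ := cQ) (κ := μ) (lam := ν) (p := b + w) (u := b) hGa ha hTloc]
    ring
  rw [e]
  exact fullSum_lin3 cK (conv_cell hGa hD hδd hT hδt μ ν b) (conv_cell hGa hN hδn hT hδt μ ν b) (conv_cell hGa hP hδp hT hδt μ ν b)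

section GlueT12

variable {a} {N : ℝ} {cE cR cK cQ ωgl : ℕ → ℝ}

/-- [folklore] **«GN-T1 ∕ GLUE» — THE GLUON NEEDLE ROW `h₁` (`SbT ⊗ SbRc`) OF `NeedleRowGlue.abs_gN_row_le_of_tables` FROM ITS THREE PIECES.**  Displayed: `0 < a`, `hGa`,
the pins `hlam`, `cE n = n⁴`, `cR n = −cE n`, and ONE n-uniform bound per piece `SbT ⊗ dip` (weight `cK n` inside), `SbT ⊗ ndl`, `SbT ⊗ proj` (`cellSum` currency;
`ωgl·cE·cR·n⁻⁸ = −2N²` is n-free by `prefactor₁_eq`).  `C₁ := 2N²·(C_d + C_n + C_p)`. -/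
theorem h₁_of_pieces (ha : 0 < a) (hGa : ∀ n : ℕ, 2 ≤ n → ∀ [NeZero n], Spr (Ga n a))
    (hlam : ∀ n : ℕ, 2 ≤ n → ωgl n * cE n ^ 2 = 2 * N ^ 2 * (n : ℝ) ^ 8) (hcE : ∀ n : ℕ, 2 ≤ n → cE n = (n : ℝ) ^ 4)
    (hR : ∀ n : ℕ, 2 ≤ n → cR n = -cE n) (μ ν : Fin 4) {Cd Cn Cp : ℝ}
    (hd : ∀ n : ℕ, 2 ≤ n → ∀ [NeZero n], |cK n * cellSum n a SbT (dipPiece n a) μ ν| ≤ Cd)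
    (hnd : ∀ n : ℕ, 2 ≤ n → ∀ [NeZero n], |cellSum n a SbT (ndlPiece n a (cQ n)) μ ν| ≤ Cn)
    (hp : ∀ n : ℕ, 2 ≤ n → ∀ [NeZero n], |cellSum n a SbT (projPiece n a) μ ν| ≤ Cp) :
    ∀ n : ℕ, 2 ≤ n → ∀ [NeZero n], |ωgl n * cE n * ∑ b ∈ (univ : Finset (Fin 4 → Fin n)).image resSite, ((n : ℝ) ^ 4)⁻¹ * (((n : ℝ) ^ 8)⁻¹ *
      fullSum (fun w : Pt => toReal w μ * toReal w ν *
        biBubbleTable (Ga n a) (Ga n a) SbT (SbRc n a (cE n) (cR n) (cK n) (cQ n)) μ ν (b + w) b))|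
      ≤ 2 * N ^ 2 * (Cd + Cn + Cp) := by
  intro n hn _
  have hGa' := hGa n hn
  have hpre : ωgl n * cE n * cR n * ((n : ℝ) ^ 8)⁻¹ = -(2 * N ^ 2) :=
    prefactor₁_eq (n := n) (cE := cE n) (cR := cR n) (ωgl := ωgl n) (N := N) (hlam n hn) (hcE n hn) (hR n hn)
  have hsign : cR n + cE n = 0 := by rw [hR n hn]; ring
  obtain ⟨Cs, δs, hδs, hS⟩ := exists_biLoc_SbT
  obtain ⟨Cr, δr, hδr, hRb⟩ := exists_biLoc_SbRblk n a (cK n) (cQ n) ha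
  have e1 : ∀ b : Pt, fullSum (fun w : Pt => toReal w μ * toReal w ν *
        biBubbleTable (Ga n a) (Ga n a) SbT (SbRc n a (cE n) (cR n) (cK n) (cQ n)) μ ν (b + w) b)
      = cR n * fullSum (fun w : Pt => toReal w μ * toReal w ν * biBubbleTable (Ga n a) (Ga n a) SbT (SbRblk n a (cK n) (cQ n)) μ ν (b + w) b) := by
    intro b
    have e : (fun w : Pt => toReal w μ * toReal w ν *
        biBubbleTable (Ga n a) (Ga n a) SbT (SbRc n a (cE n) (cR n) (cK n) (cQ n)) μ ν (b + w) b)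
        = fun w : Pt => cR n * (toReal w μ * toReal w ν * biBubbleTable (Ga n a) (Ga n a) SbT (SbRblk n a (cK n) (cQ n)) μ ν (b + w) b) := by
      funext w
      rw [biBubbleTable_right_SbRc_eq (n := n) (a := a) (cE := cE n) (cR := cR n) (cK := cK n) (cQ := cQ n) (κ := μ) (lam := ν)
        (p := b + w) (u := b) (Ga n a) (Ga n a) SbT hsign]
      ring
    rw [e, fullSum_const_mul _ (conv_cell hGa' hS hδs hRb hδr μ ν b)]
  have e2 : ∑ b ∈ (univ : Finset (Fin 4 → Fin n)).image resSite, ((n : ℝ) ^ 4)⁻¹ * (((n : ℝ) ^ 8)⁻¹ *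
      fullSum (fun w : Pt => toReal w μ * toReal w ν *
        biBubbleTable (Ga n a) (Ga n a) SbT (SbRc n a (cE n) (cR n) (cK n) (cQ n)) μ ν (b + w) b))
      = ((n : ℝ) ^ 8)⁻¹ * cR n * (cK n * cellSum n a SbT (dipPiece n a) μ ν + cellSum n a SbT (ndlPiece n a (cQ n)) μ ν
          - cellSum n a SbT (projPiece n a) μ ν) := by
    simp only [cellSum_def]
    rw [← sum_avg_three, Finset.mul_sum]
    refine Finset.sum_congr rfl fun b _ => ?_
    rw [e1 b, fullSum_right_SbRblk_eq n a (cK n) (cQ n) ha hGa' hS hδs μ ν b]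
    ring
  rw [e2]
  have e3 : ωgl n * cE n * (((n : ℝ) ^ 8)⁻¹ * cR n * (cK n * cellSum n a SbT (dipPiece n a) μ ν + cellSum n a SbT (ndlPiece n a (cQ n)) μ ν
        - cellSum n a SbT (projPiece n a) μ ν))
      = -(2 * N ^ 2) * (cK n * cellSum n a SbT (dipPiece n a) μ ν + cellSum n a SbT (ndlPiece n a (cQ n)) μ ν
          - cellSum n a SbT (projPiece n a) μ ν) := by
    rw [← hpre]; ring
  rw [e3, abs_mul, abs_neg, abs_of_nonneg (by positivity : (0 : ℝ) ≤ 2 * N ^ 2)]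
  refine mul_le_mul_of_nonneg_left ?_ (by positivity)
  refine (abs_three_le _ _ _ _).trans ?_
  have h1 := hd n hn; have h2 := hnd n hn; have h3 := hp n hn
  linarith

/-- [folklore] **«GN-T2 ∕ GLUE» — THE GLUON NEEDLE ROW `h₂` (`SbRc ⊗ SbT`) FROM ITS THREE PIECES** (mirror of `h₁_of_pieces`; `C₂ := 2N²·(C_d + C_n + C_p)`). -/
theorem h₂_of_pieces (ha : 0 < a) (hGa : ∀ n : ℕ, 2 ≤ n → ∀ [NeZero n], Spr (Ga n a))
    (hlam : ∀ n : ℕ, 2 ≤ n → ωgl n * cE n ^ 2 = 2 * N ^ 2 * (n : ℝ) ^ 8) (hcE : ∀ n : ℕ, 2 ≤ n → cE n = (n : ℝ) ^ 4)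
    (hR : ∀ n : ℕ, 2 ≤ n → cR n = -cE n) (μ ν : Fin 4) {Cd Cn Cp : ℝ}
    (hd : ∀ n : ℕ, 2 ≤ n → ∀ [NeZero n], |cK n * cellSum n a (dipPiece n a) SbT μ ν| ≤ Cd)
    (hnd : ∀ n : ℕ, 2 ≤ n → ∀ [NeZero n], |cellSum n a (ndlPiece n a (cQ n)) SbT μ ν| ≤ Cn)
    (hp : ∀ n : ℕ, 2 ≤ n → ∀ [NeZero n], |cellSum n a (projPiece n a) SbT μ ν| ≤ Cp) :
    ∀ n : ℕ, 2 ≤ n → ∀ [NeZero n], |ωgl n * cE n * ∑ b ∈ (univ : Finset (Fin 4 → Fin n)).image resSite, ((n : ℝ) ^ 4)⁻¹ * (((n : ℝ) ^ 8)⁻¹ *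
      fullSum (fun w : Pt => toReal w μ * toReal w ν *
        biBubbleTable (Ga n a) (Ga n a) (SbRc n a (cE n) (cR n) (cK n) (cQ n)) SbT μ ν (b + w) b))|
      ≤ 2 * N ^ 2 * (Cd + Cn + Cp) := by
  intro n hn _
  have hGa' := hGa n hn
  have hpre : ωgl n * cE n * cR n * ((n : ℝ) ^ 8)⁻¹ = -(2 * N ^ 2) :=
    prefactor₁_eq (n := n) (cE := cE n) (cR := cR n) (ωgl := ωgl n) (N := N) (hlam n hn) (hcE n hn) (hR n hn)
  have hsign : cR n + cE n = 0 := by rw [hR n hn]; ring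
  obtain ⟨Cs, δs, hδs, hS⟩ := exists_biLoc_SbT
  obtain ⟨Cr, δr, hδr, hRb⟩ := exists_biLoc_SbRblk n a (cK n) (cQ n) ha
  have e1 : ∀ b : Pt, fullSum (fun w : Pt => toReal w μ * toReal w ν *
        biBubbleTable (Ga n a) (Ga n a) (SbRc n a (cE n) (cR n) (cK n) (cQ n)) SbT μ ν (b + w) b)
      = cR n * fullSum (fun w : Pt => toReal w μ * toReal w ν * biBubbleTable (Ga n a) (Ga n a) (SbRblk n a (cK n) (cQ n)) SbT μ ν (b + w) b) := by
    intro b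
    have e : (fun w : Pt => toReal w μ * toReal w ν *
        biBubbleTable (Ga n a) (Ga n a) (SbRc n a (cE n) (cR n) (cK n) (cQ n)) SbT μ ν (b + w) b)
        = fun w : Pt => cR n * (toReal w μ * toReal w ν * biBubbleTable (Ga n a) (Ga n a) (SbRblk n a (cK n) (cQ n)) SbT μ ν (b + w) b) := by
      funext w
      rw [biBubbleTable_left_SbRc_eq (n := n) (a := a) (cE := cE n) (cR := cR n) (cK := cK n) (cQ := cQ n) (κ := μ) (lam := ν)
        (p := b + w) (u := b) (Ga n a) (Ga n a) SbT hsign]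
      ring
    rw [e, fullSum_const_mul _ (conv_cell hGa' hRb hδr hS hδs μ ν b)]
  have e2 : ∑ b ∈ (univ : Finset (Fin 4 → Fin n)).image resSite, ((n : ℝ) ^ 4)⁻¹ * (((n : ℝ) ^ 8)⁻¹ *
      fullSum (fun w : Pt => toReal w μ * toReal w ν *
        biBubbleTable (Ga n a) (Ga n a) (SbRc n a (cE n) (cR n) (cK n) (cQ n)) SbT μ ν (b + w) b))
      = ((n : ℝ) ^ 8)⁻¹ * cR n * (cK n * cellSum n a (dipPiece n a) SbT μ ν + cellSum n a (ndlPiece n a (cQ n)) SbT μ ν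
          - cellSum n a (projPiece n a) SbT μ ν) := by
    simp only [cellSum_def]
    rw [← sum_avg_three, Finset.mul_sum]
    refine Finset.sum_congr rfl fun b _ => ?_
    rw [e1 b, fullSum_left_SbRblk_eq n a (cK n) (cQ n) ha hGa' hS hδs μ ν b]
    ring
  rw [e2]
  have e3 : ωgl n * cE n * (((n : ℝ) ^ 8)⁻¹ * cR n * (cK n * cellSum n a (dipPiece n a) SbT μ ν + cellSum n a (ndlPiece n a (cQ n)) SbT μ ν
        - cellSum n a (projPiece n a) SbT μ ν))
      = -(2 * N ^ 2) * (cK n * cellSum n a (dipPiece n a) SbT μ ν + cellSum n a (ndlPiece n a (cQ n)) SbT μ ν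
          - cellSum n a (projPiece n a) SbT μ ν) := by
    rw [← hpre]; ring
  rw [e3, abs_mul, abs_neg, abs_of_nonneg (by positivity : (0 : ℝ) ≤ 2 * N ^ 2)]
  refine mul_le_mul_of_nonneg_left ?_ (by positivity)
  refine (abs_three_le _ _ _ _).trans ?_
  have h1 := hd n hn; have h2 := hnd n hn; have h3 := hp n hn
  linarith

end GlueT12

end Summit.QuantumFields.BalabanUV.Beta.D1BFx.GluonNeedleGlueT12

end
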